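import Summits.ResolutionOfSingularities.ResolutionOfSingularities.Theorems.PurelyInseparableDim4PureLeafFpForms
import Literature.AlgebraicGeometry.Resolution.WeightedBlowupNoIncrease
import HarnessLib
import HarnessLib.Audit.Tags

/-!
# Purely inseparable fourfolds — BLOCK CHARTS, ORDERS and TERMINAL POSITIONS of the general form over `𝔽_p`
# (cell res-dim4-pi; D3c kit G of `HOME/res-dim4-p-10/D3c-PAPER.md` §3–§4)
# [OURS · counted 0 · bookkeeping identities of OUR frame, not about resolution]

Width seat `res-dim4-p-10` (g3).  Companion of kit F (`…PureLeafFpForms`: the shape `expand p N(n)·(N(μ) − C γ₀)` and its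
singleton move).  Here:

* §1 orders of PRODUCT states `N(p n + μ)`: `ordAlong_generalForm_C_zero` (`ord_{(x_S)} = Σ_{i∈S} (p·n i 0 + μ i 0)`), and
  a singleton centre `{x_j}` with `1 ≤ n j 0` is permissible at EVERY general form (`le_ordAlong_singleton_generalForm`);
* §2 the BLOCK CHART of a centre `S` of pure monomial variables (`|S| ≥ 2`, no singleton available): `splitForm_block_eq`,
  `chartTransform_block_splitForm` and the whole move **`step_block_generalForm`** — again `(n, μ) ↦ (shift n, shift μ′)`
  with `μ′ j 0 = Σ_S μ i 0 − p`;
* §3 TERMINAL positions of the bracket regime (`γ(μ) ≠ 0`, no `n j 0 ≥ 1`): the linear coefficient `x_i` of the general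
  form at an active variable is non-zero (`coeff_single_one_mul`, `coeff_zero_splitForm`, `coeff_single_generalForm`), so
  its order along every coordinate centre is `≤ 1` (`ordAlong_generalForm_le_one`).

Nothing here proves resolution of singularities in dimension ≥ 4 / characteristic `p`; counted 0; AI work, weaker than
expert review. bears_on: LADDER-RESOLUTION:D157-DOOR2 (res-dim4-pi · D3c kit G). Supports stmt-ResolutionOfSingularities-16155
(helper).
-/

set_option linter.dupNamespace false

open MvPolynomial Finset

open scoped BigOperators

noncomputable section

namespace Summit.ResolutionOfSingularities.ResolutionOfSingularities.Theorems.PIDim4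

namespace PureLeafNF

open Literature.AlgebraicGeometry.Resolution
open Literature.AlgebraicGeometry.Resolution.Hauser2010
open CentreBlowup PthPowerFactor

variable {σ : Type*} [Fintype σ] [DecidableEq σ] (p : ℕ) [Fact p.Prime]

/-! ## 1. Orders -/

omit [DecidableEq σ] in
/-- **Order of a product state along a coordinate centre**: `ord_{(x_S)} (expand N(n)·(N(μ) − C 0)) = Σ_{i∈S} (p·n i 0 + μ i 0)`.
[folklore] -/
theorem ordAlong_generalForm_C_zero (n μ : σ → ZMod p → ℕ) (S : Finset σ) :
    ordAlong S (expand p (∏ i, ∏ c, (X i + C c) ^ n i c : MvPolynomial σ (ZMod p)) *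
        ((∏ i, ∏ c, (X i + C c) ^ μ i c) - C 0)) =
      ((∑ i ∈ S, (p * n i 0 + μ i 0) : ℕ) : ℕ∞) := by
  rw [generalForm_C_zero, ordAlong_splitForm]
  rfl

/-- **A singleton centre `{x_j}` with `1 ≤ n j 0` is permissible at every general form.** [folklore] -/
theorem le_ordAlong_singleton_generalForm (n μ : σ → ZMod p → ℕ) (γ₀ : ZMod p) {j : σ} (hj : 1 ≤ n j 0) :
    (p : ℕ∞) ≤ ordAlong {j} (expand p (∏ i, ∏ c, (X i + C c) ^ n i c : MvPolynomial σ (ZMod p)) *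
        ((∏ i, ∏ c, (X i + C c) ^ μ i c) - C γ₀)) := by
  rw [expand_splitForm_eq_X_pow_mul p n hj, mul_assoc]
  refine le_trans ?_ (ordAlong_add_ordAlong_le_mul {j} _ _)
  rw [ordAlong_X_pow, if_pos (Finset.mem_singleton_self j)]
  exact le_self_add

/-! ## 2. The block chart of pure monomial variables -/

omit [Fintype σ] [DecidableEq σ] [Fact p.Prime] in
/-- A product of pure powers is a monomial: `∏_{i∈S} Xᵢ^{kᵢ} = monomial (Σ_{i∈S} kᵢ·eᵢ) 1`. [folklore] -/
theorem prod_X_pow_eq_monomial {L : Type*} [CommRing L] (S : Finset σ) (k : σ → ℕ) :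
    (∏ i ∈ S, X i ^ k i : MvPolynomial σ L) = monomial (∑ i ∈ S, Finsupp.single i (k i)) 1 := by
  rw [monomial_sum_one]
  exact Finset.prod_congr rfl fun i _ => by rw [X_pow_eq_monomial]

omit [Fintype σ] [Fact p.Prime] in
/-- `(Σ_{i∈S} kᵢ·eᵢ) t = k t` on `S` and `0` off `S`. [folklore] -/
theorem sum_single_apply (S : Finset σ) (k : σ → ℕ) (t : σ) :
    (∑ i ∈ S, Finsupp.single i (k i)) t = if t ∈ S then k t else 0 := by
  rw [Finsupp.finsetSum_apply]
  simp_rw [Finsupp.single_apply]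
  rw [Finset.sum_ite_eq']

/-- **Block decomposition**: if the variables of `S` are pure (`m i c = 0` for `c ≠ 0`), then
`N(m) = monomial (Σ_{i∈S} (m i 0)·eᵢ) 1 · ∏_{i∉S} ∏_c (Xᵢ + C c)^{m i c}`. [folklore] -/
theorem splitForm_block_eq (m : σ → ZMod p → ℕ) (S : Finset σ) (hpure : ∀ i ∈ S, ∀ c, c ≠ 0 → m i c = 0) :
    (∏ i, ∏ c, (X i + C c) ^ m i c : MvPolynomial σ (ZMod p)) =
      monomial (∑ i ∈ S, Finsupp.single i (m i 0)) 1 * ∏ i ∈ Sᶜ, ∏ c, (X i + C c) ^ m i c := by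
  rw [← Finset.prod_mul_prod_compl S, ← prod_X_pow_eq_monomial]
  congr 1
  refine Finset.prod_congr rfl fun i hi => ?_
  rw [← Finset.mul_prod_erase Finset.univ _ (Finset.mem_univ (0 : ZMod p)), C_0, add_zero,
    Finset.prod_eq_one fun c hc => ?_, mul_one]
  rw [hpure i hi c (Finset.ne_of_mem_erase hc), pow_zero]

/-- **The block chart**: centre `S` of pure variables, chart `j ∈ S`: the exponent of `x_j` becomes `Σ_{i∈S} m i 0 − p`,
everything else is kept. [folklore] -/
theorem chartTransform_block_splitForm (m : σ → ZMod p → ℕ) (S : Finset σ) {j : σ} (hj : j ∈ S)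
    (hpure : ∀ i ∈ S, ∀ c, c ≠ 0 → m i c = 0) :
    chartTransform p S j (∏ i, ∏ c, (X i + C c) ^ m i c : MvPolynomial σ (ZMod p)) =
      ∏ i, ∏ c, (X i + C c) ^ (if i = j ∧ c = 0 then (∑ i ∈ S, m i 0) - p else m i c) := by
  have hpure' : ∀ i ∈ S, ∀ c, c ≠ 0 → (if i = j ∧ c = 0 then (∑ i ∈ S, m i 0) - p else m i c) = 0 :=
    fun i hi c hc => by rw [if_neg (fun h => hc h.2)]; exact hpure i hi c hc
  rw [splitForm_block_eq p m S hpure, splitForm_block_eq p _ S hpure',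
    MohAlong.chartTransform_mul_offS hj p _ _ (fun k hk i hi =>
      apply_eq_zero_of_mem_support_prod_linearFactors Finset.univ Sᶜ (fun c : ZMod p => c) m hk
        (fun h => (Finset.mem_compl.mp h) hi)),
    chartTransform_monomial]
  have hcof : (∏ i ∈ Sᶜ, ∏ c, (X i + C c) ^ m i c : MvPolynomial σ (ZMod p)) =
      ∏ i ∈ Sᶜ, ∏ c, (X i + C c) ^ (if i = j ∧ c = 0 then (∑ i ∈ S, m i 0) - p else m i c) :=
    Finset.prod_congr rfl fun i hi => Finset.prod_congr rfl fun c _ => by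
      have hij : i ≠ j := fun h => (Finset.mem_compl.mp hi) (h ▸ hj)
      rw [if_neg (fun h => hij h.1)]
  have hexp : chartExponent p S j (∑ i ∈ S, Finsupp.single i (m i 0)) =
      ∑ i ∈ S, Finsupp.single i (if i = j ∧ (0 : ZMod p) = 0 then (∑ i ∈ S, m i 0) - p else m i 0) := by
    rw [chartExponent_eq_iff]
    refine ⟨?_, fun i hi => ?_⟩
    · rw [sum_single_apply, if_pos hj, if_pos ⟨rfl, rfl⟩]
      unfold degIn
      congr 1
      exact Finset.sum_congr rfl fun i hi => by rw [sum_single_apply, if_pos hi]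
    · rw [sum_single_apply, sum_single_apply]
      by_cases hiS : i ∈ S
      · rw [if_pos hiS, if_pos hiS, if_neg (fun h => hi h.1)]
      · rw [if_neg hiS, if_neg hiS]
  rw [hcof, hexp]

/-- **THE BLOCK MOVE on a product state.** State `F = expand N(n)·(N(μ) − C 0)`, centre `S` of pure variables with `n i 0 = 0`
on `S` (`|S| ≥ 2` in use: no singleton is permissible), chart `j ∈ S`, `p ≤ Σ_S μ i 0 < 2p`, ANY reply `b`: the cleaned
transform is `expand N(shift n)·(N(μ₂) − C γ(μ₂))` with `μ₂` the shift of `μ` after `μ j 0 ↦ Σ_S μ i 0 − p`.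
[OURS · counted 0] [folklore] -/
theorem step_block_generalForm (s : CState σ (ZMod p)) (n μ : σ → ZMod p → ℕ)
    (hF : s.F = expand p (∏ i, ∏ c, (X i + C c) ^ n i c : MvPolynomial σ (ZMod p)) *
      ((∏ i, ∏ c, (X i + C c) ^ μ i c) - C 0))
    (hμ : ∀ i c, μ i c < p) (h1 : ∀ i c, μ i c ≠ 0 → ∀ c', c' ≠ c → μ i c' = 0)
    (S : Finset σ) {j : σ} (hj : j ∈ S) (hn : ∀ i ∈ S, ∀ c, n i c = 0) (hμS : ∀ i ∈ S, ∀ c, c ≠ 0 → μ i c = 0)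
    (hlt : (∑ i ∈ S, μ i 0) - p < p) (b : σ → ZMod p) :
    (step p S j b s).F =
      expand p (∏ i, ∏ c, (X i + C c) ^ n i (c - b i) : MvPolynomial σ (ZMod p)) *
        ((∏ i, ∏ c, (X i + C c) ^ (if i = j ∧ c - b i = 0 then (∑ i ∈ S, μ i 0) - p else μ i (c - b i))) -
          C (∏ i, ∏ c, (c : ZMod p) ^ (if i = j ∧ c - b i = 0 then (∑ i ∈ S, μ i 0) - p else μ i (c - b i)))) := by
  -- the state as a split form, the block chart, back to the general form with constant `0`
  have hpure : ∀ i ∈ S, ∀ c, c ≠ 0 → p * n i c + μ i c = 0 := fun i hi c hc => by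
    rw [hn i hi c, hμS i hi c hc, mul_zero]
  have hsum : (∑ i ∈ S, (p * n i 0 + μ i 0)) = ∑ i ∈ S, μ i 0 :=
    Finset.sum_congr rfl fun i hi => by rw [hn i hi 0, mul_zero, zero_add]
  have hchart : chartTransform p S j s.F =
      expand p (∏ i, ∏ c, (X i + C c) ^ n i c : MvPolynomial σ (ZMod p)) *
        ((∏ i, ∏ c, (X i + C c) ^ (if i = j ∧ c = 0 then (∑ i ∈ S, μ i 0) - p else μ i c)) - C 0) := by
    rw [hF, generalForm_C_zero, chartTransform_block_splitForm p _ S hj hpure, generalForm_C_zero, hsum]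
    refine Finset.prod_congr rfl fun i _ => Finset.prod_congr rfl fun c _ => ?_
    by_cases h : i = j ∧ c = 0
    · rw [if_pos h, if_pos h, h.1, h.2, hn j hj 0, mul_zero, zero_add]
    · rw [if_neg h, if_neg h]
  have hμ' : ∀ i c, (if i = j ∧ c = 0 then (∑ i ∈ S, μ i 0) - p else μ i c) < p := fun i c => by
    split_ifs
    · exact hlt
    · exact hμ i c
  have h1' : ∀ i c, (if i = j ∧ c = 0 then (∑ i ∈ S, μ i 0) - p else μ i c) ≠ 0 →
      ∀ c', c' ≠ c → (if i = j ∧ c' = 0 then (∑ i ∈ S, μ i 0) - p else μ i c') = 0 := fun i c hc c' hc' => by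
    by_cases hij : i = j
    · subst hij
      by_cases hc0 : c = 0
      · rw [if_neg (fun h => hc' (h.2.trans hc0.symm))]
        exact hμS i hj c' (fun h => hc' (h.trans hc0.symm))
      · rw [if_neg (fun h => hc0 h.2)] at hc
        have := hμS i hj c hc0
        exact absurd this hc
    · rw [if_neg (fun h => hij h.1)] at hc ⊢
      exact h1 i c hc c' hc'
  change deletePthPowers p (PointBlowup.translate b (chartTransform p S j s.F)) = _
  rw [hchart, translate_generalForm]
  exact deletePthPowers_generalForm p (fun i c => n i (c - b i))
    (fun i c => if i = j ∧ c - b i = 0 then (∑ i ∈ S, μ i 0) - p else μ i (c - b i)) 0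
    (small_shift hμ' b) (singleRoot_shift h1' b)

/-! ## 3. Terminal positions of the bracket regime -/

omit [Fintype σ] [Fact p.Prime] in
/-- The linear coefficient of a product: `coeff eᵢ (P·Q) = P(0)·coeff eᵢ Q + coeff eᵢ P·Q(0)`. [folklore] -/
theorem coeff_single_one_mul {L : Type*} [CommRing L] (i : σ) (P Q : MvPolynomial σ L) :
    coeff (Finsupp.single i 1) (P * Q) = coeff 0 P * coeff (Finsupp.single i 1) Q + coeff (Finsupp.single i 1) P * coeff 0 Q := by
  rw [coeff_mul, Finsupp.antidiagonal_single, Finset.sum_map, Finset.Nat.sum_antidiagonal_succ,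
    Finset.Nat.antidiagonal_zero, Finset.sum_singleton]
  simp [Finsupp.single_zero]

omit [DecidableEq σ] in
/-- The constant coefficient of a split form: `N(m)(0) = ∏ᵢ ∏_c c^{m i c}`. [folklore] -/
theorem coeff_zero_splitForm (m : σ → ZMod p → ℕ) :
    coeff 0 (∏ i, ∏ c, (X i + C c) ^ m i c : MvPolynomial σ (ZMod p)) = ∏ i, ∏ c, (c : ZMod p) ^ m i c := by
  rw [← constantCoeff_eq, map_prod]
  refine Finset.prod_congr rfl fun i _ => ?_
  rw [map_prod]
  refine Finset.prod_congr rfl fun c _ => ?_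
  rw [map_pow, map_add, constantCoeff_X, constantCoeff_C, zero_add]

omit [DecidableEq σ] in
/-- An exponent array with ONE active root `r i` per variable, written with one linear factor per variable:
`N(μ) = ∏ᵢ (Xᵢ + C (r i))^{μ i (r i)}`. [folklore] -/
theorem splitForm_eq_prod_linearPow (μ : σ → ZMod p → ℕ) (r : σ → ZMod p) (hr : ∀ i c, μ i c ≠ 0 → r i = c) :
    (∏ i, ∏ c, (X i + C c) ^ μ i c : MvPolynomial σ (ZMod p)) = ∏ i, (X i + C (r i)) ^ μ i (r i) := by
  refine Finset.prod_congr rfl fun i _ => ?_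
  rw [← Finset.mul_prod_erase Finset.univ _ (Finset.mem_univ (r i)), Finset.prod_eq_one fun c hc => ?_, mul_one]
  have hne := Finset.ne_of_mem_erase hc
  by_cases h0 : μ i c = 0
  · rw [h0, pow_zero]
  · exact absurd (hr i c h0) (Ne.symm hne)

/-- **The linear coefficient `xᵢ` of the general form at an active variable** (no `x_j`-power in the `p`-th-power part:
all `n j 0 = 0`): `N(p n)(0) · μᵢ · rᵢ^{μᵢ − 1} · ∏_{k ≠ i} r_k^{μ_k}`. [folklore] -/
theorem coeff_single_generalForm (n μ : σ → ZMod p → ℕ) (γ₀ : ZMod p) (r : σ → ZMod p)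
    (hr : ∀ i c, μ i c ≠ 0 → r i = c) (i : σ) :
    coeff (Finsupp.single i 1) (expand p (∏ k, ∏ c, (X k + C c) ^ n k c : MvPolynomial σ (ZMod p)) *
        ((∏ k, ∏ c, (X k + C c) ^ μ k c) - C γ₀)) =
      (∏ k, ∏ c, (c : ZMod p) ^ (p * n k c)) *
        ∏ k, (((μ k (r k)).choose (Finsupp.single i 1 k) : ZMod p) * r k ^ (μ k (r k) - Finsupp.single i 1 k)) := by
  rw [coeff_single_one_mul, expand_splitForm, coeff_zero_splitForm, coeff_sub, coeff_sub, coeff_C,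
    if_neg (Finsupp.single_ne_zero.mpr one_ne_zero).symm, sub_zero, coeff_zero_splitForm, coeff_C, if_pos rfl,
    splitForm_eq_prod_linearPow p μ r hr, WeightedBlowup.coeff_prod_X_add_C_pow]
  -- the bracket has no constant term: `N(μ)(0) = γ(μ)`… its contribution is multiplied by `coeff eᵢ (expand …) · (γ − γ₀)`;
  -- we only need the shape `E(0)·(linear coeff of N(μ)) + (linear coeff of E)·(N(μ)(0) − γ₀)` with the second
  -- linear coefficient zero: `eᵢ` is not divisible by `p`
  have hE : coeff (Finsupp.single i 1) (∏ k, ∏ c, (X k + C c) ^ (p * n k c) : MvPolynomial σ (ZMod p)) = 0 := by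
    rw [← expand_splitForm]
    exact coeff_expand_of_not_dvd _ (fun h => by
      have := h; rw [Finsupp.single_eq_same] at this
      exact Nat.Prime.one_lt (Fact.out : p.Prime) |>.ne' (Nat.dvd_one.mp this))
  rw [hE, zero_mul, add_zero]

/-- **THE BRACKET REGIME WITHOUT AN `x_j^p` IS TERMINAL**: if `μ` is single-rooted and small with all active roots non-zero,
some variable `i₀` is active, and `n j 0 = 0` for every `j`, then the general form has the monomial `x_{i₀}` with non-zero
coefficient, so its order along every coordinate centre is `≤ 1` (`< p`: no permissible centre). [folklore] -/
theorem ordAlong_generalForm_le_one (n μ : σ → ZMod p → ℕ) (γ₀ : ZMod p) (hμ : ∀ i c, μ i c < p)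
    (h1 : ∀ i c, μ i c ≠ 0 → ∀ c', c' ≠ c → μ i c' = 0) (hact : ∀ i c, μ i c ≠ 0 → c ≠ 0)
    (hn0 : ∀ j, n j 0 = 0) {i₀ : σ} {c₀ : ZMod p} (hi₀ : μ i₀ c₀ ≠ 0) (S : Finset σ) :
    ordAlong S (expand p (∏ k, ∏ c, (X k + C c) ^ n k c : MvPolynomial σ (ZMod p)) *
        ((∏ k, ∏ c, (X k + C c) ^ μ k c) - C γ₀)) ≤ 1 := by
  classical
  -- a choice of the active root of every variable
  let r : σ → ZMod p := fun i => if h : ∃ c, μ i c ≠ 0 then h.choose else 0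
  have hr : ∀ i c, μ i c ≠ 0 → r i = c := fun i c hc => by
    have hex : ∃ c, μ i c ≠ 0 := ⟨c, hc⟩
    have hri : r i = hex.choose := dif_pos hex
    rw [hri]
    by_contra hne
    exact hex.choose_spec (h1 i c hc _ hne)
  have hcoeff := coeff_single_generalForm p n μ γ₀ r hr i₀
  have hne : coeff (Finsupp.single i₀ 1) (expand p (∏ k, ∏ c, (X k + C c) ^ n k c : MvPolynomial σ (ZMod p)) *
      ((∏ k, ∏ c, (X k + C c) ^ μ k c) - C γ₀)) ≠ 0 := by
    rw [hcoeff]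
    refine mul_ne_zero ?_ ?_
    · refine Finset.prod_ne_zero_iff.mpr fun k _ => Finset.prod_ne_zero_iff.mpr fun c _ => ?_
      by_cases hc : c = 0
      · rw [hc, hn0 k, mul_zero, pow_zero]; exact one_ne_zero
      · exact pow_ne_zero _ hc
    · refine Finset.prod_ne_zero_iff.mpr fun k _ => ?_
      by_cases hk : k = i₀
      · subst hk
        have hrk : r k = c₀ := hr k c₀ hi₀
        rw [Finsupp.single_eq_same, Nat.choose_one_right, hrk]
        refine mul_ne_zero ?_ (pow_ne_zero _ (hact k c₀ hi₀))
        rw [Ne, ZMod.natCast_eq_zero_iff]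
        exact fun hdvd => absurd (Nat.le_of_dvd (Nat.pos_of_ne_zero hi₀) hdvd) (not_le.mpr (hμ k c₀))
      · rw [Finsupp.single_eq_of_ne hk, Nat.choose_zero_right, Nat.cast_one, one_mul, Nat.sub_zero]
        by_cases h0 : μ k (r k) = 0
        · rw [h0, pow_zero]; exact one_ne_zero
        · exact pow_ne_zero _ (hact k (r k) h0)
  have hle := ordAlong_le_of_coeff_ne_zero (S := S) hne
  refine le_trans hle ?_
  rw [degIn_single]
  split_ifs <;> simp

end PureLeafNF

end Summit.ResolutionOfSingularities.ResolutionOfSingularities.Theorems.PIDim4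

end
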